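import Summits.AtomisticToContinuum.HydrodynamicLimit.Theorems.AntiMazurCoboundariesKineticFluxLdDecayHTheoremObjectsD
import Summits.AtomisticToContinuum.HydrodynamicLimit.Theorems.AntiMazurCoboundariesKineticFluxLdDecayGainDominationLocal
import Summits.AtomisticToContinuum.HydrodynamicLimit.Theorems.JParityClosureFirstOrderOddResponseParity
import HarnessLib

/-!
# A-priori bound on the Hellinger production below a density cut (crux `KineticFluxLdDecay`,
# stmt-AtomisticToContinuum-10967) — registered stub `stub_cutProductionLeMoment` (objects part D)

In the frame of `Theorems/AntiMazurCoboundariesKineticFluxLdDecayHTheoremObjects.lean` (statement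
`HTheorem.CutProductionLeMoment` of `…HTheoremObjectsD.lean`): there is an absolute constant `c ≥ 0` such that
for every finite one-body law `f ≪ m = vol ⊗ γ` on `𝕋³ × ℝ³` and every cut level `K ≥ 0`, the Hellinger
production of the density `df/dm` with the fibres `{x | n(x) > K}` zeroed (`n = d f₁/d vol`) is at most
`c · K · ∫⁻ ‖w‖ df`. Proof (everything `ℝ≥0∞`-valued, no integrability side conditions):

* pointwise `(√a √b − √c √d)² ≤ a b + c d` for `a, b, c, d ≥ 0`, so the fibre integrand is at most
  `B M M_* (ρ'ρ'_* + ρ ρ_*)`;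
* the gain half equals the loss half (`lintegral_collisionDensity_mul_comp_collide_negDir`: the involution
  `(v, v_*, ω) ↦ (v', v_*', −ω)` preserves `dv dv_* dω` and `B M M_*`);
* `B = ((v − v_*)·ω)₊ ≤ ‖v‖ + ‖v_*‖` and `|S²| < ∞`, so by Tonelli a fibre produces at most
  `4 |S²| n(x) ∫ ‖w‖ ρ(x, w) γ(dw)` with `n(x) = ∫ ρ(x, w) γ(dw)` (bridge `γ = M dv`);
* `f₁ = (∫ df/dm dγ) · vol`, so `n ≤ K` a.e. on the kept fibres (`Measure.rnDeriv_withDensity`), and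
  `∫ dx ∫ ‖w‖ (df/dm) dγ = ∫ ‖w‖ df`; the constant is `c = 4 |S²|`.

Reference: C. Cercignani, R. Illner, M. Pulvirenti, *The Mathematical Theory of Dilute Gases* (1994), §3.1
(micro-reversibility of the hard-sphere kernel).
-/

noncomputable section

open MeasureTheory ProbabilityTheory Set Filter
open scoped ENNReal InnerProductSpace

namespace Summit.AtomisticToContinuum.HydrodynamicLimit.Theorems.HTheorem

open Literature.MathematicalPhysics.KineticTheory (T3 V3 collide sphereMeasure hardSphereKernel)
open Literature.Analysis.FluidPDE (globalMaxwellian globalMaxwellian_pos continuous_globalMaxwellian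
  isFiniteMeasure_sphereMeasure stdGaussian_eq_withDensity_globalMaxwellian_holds)
open Literature.Analysis.UnboundedOperators (collisionDensity collisionDensity_nonneg
  measurable_collisionDensity)

namespace CutProduction

/-! ### Pointwise bounds -/

/-- `(√a √b − √c √d)² ≤ a b + c d` for nonnegative reals. -/
theorem sq_sqrt_mul_sub_le {a b c d : ℝ} (ha : 0 ≤ a) (hb : 0 ≤ b) (hc : 0 ≤ c) (hd : 0 ≤ d) :
    (Real.sqrt a * Real.sqrt b - Real.sqrt c * Real.sqrt d) ^ 2 ≤ a * b + c * d := by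
  have hp : 0 ≤ Real.sqrt a * Real.sqrt b := mul_nonneg (Real.sqrt_nonneg _) (Real.sqrt_nonneg _)
  have hq : 0 ≤ Real.sqrt c * Real.sqrt d := mul_nonneg (Real.sqrt_nonneg _) (Real.sqrt_nonneg _)
  have h1 : (Real.sqrt a * Real.sqrt b) ^ 2 = a * b := by
    rw [mul_pow, Real.sq_sqrt ha, Real.sq_sqrt hb]
  have h2 : (Real.sqrt c * Real.sqrt d) ^ 2 = c * d := by
    rw [mul_pow, Real.sq_sqrt hc, Real.sq_sqrt hd]
  nlinarith [mul_nonneg hp hq]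

/-- The fibre integrand of the production of `(g ·).toReal` is at most `B M M_* (g' g'_* + g g_*)`. -/
theorem integrand_le (g : V3 → ℝ≥0∞) (q : CollSpace) :
    ENNReal.ofReal (collisionDensity q * hellingerDefect (fun w => (g w).toReal) q ^ 2) ≤
      ENNReal.ofReal (collisionDensity q) * (g (collide q.2 q.1).1 * g (collide q.2 q.1).2) +
        ENNReal.ofReal (collisionDensity q) * (g q.1.1 * g q.1.2) := by
  rw [ENNReal.ofReal_mul (collisionDensity_nonneg q), ← mul_add]
  gcongr
  calc ENNReal.ofReal (hellingerDefect (fun w => (g w).toReal) q ^ 2)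
      ≤ ENNReal.ofReal ((g (collide q.2 q.1).1).toReal * (g (collide q.2 q.1).2).toReal +
          (g q.1.1).toReal * (g q.1.2).toReal) :=
        ENNReal.ofReal_le_ofReal (sq_sqrt_mul_sub_le ENNReal.toReal_nonneg ENNReal.toReal_nonneg
          ENNReal.toReal_nonneg ENNReal.toReal_nonneg)
    _ = ENNReal.ofReal (g (collide q.2 q.1).1).toReal * ENNReal.ofReal (g (collide q.2 q.1).2).toReal +
          ENNReal.ofReal (g q.1.1).toReal * ENNReal.ofReal (g q.1.2).toReal := by
        rw [ENNReal.ofReal_add (mul_nonneg ENNReal.toReal_nonneg ENNReal.toReal_nonneg)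
          (mul_nonneg ENNReal.toReal_nonneg ENNReal.toReal_nonneg),
          ENNReal.ofReal_mul ENNReal.toReal_nonneg, ENNReal.ofReal_mul ENNReal.toReal_nonneg]
    _ ≤ _ := by
        gcongr <;> exact ENNReal.ofReal_toReal_le

/-- The kernel bound `B M M_* ≤ (‖v‖ + ‖v_*‖) M(v) M(v_*)` (`((v − v_*)·ω)₊ ≤ ‖v − v_*‖ ≤ ‖v‖ + ‖v_*‖`). -/
theorem ofReal_collisionDensity_le (q : CollSpace) :
    ENNReal.ofReal (collisionDensity q) ≤
      (‖q.1.1‖ₑ + ‖q.1.2‖ₑ) *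
        (ENNReal.ofReal (globalMaxwellian q.1.1) * ENNReal.ofReal (globalMaxwellian q.1.2)) := by
  have hB0 : 0 ≤ hardSphereKernel q.1 q.2 := le_max_right _ _
  have hB : hardSphereKernel q.1 q.2 ≤ ‖q.1.1‖ + ‖q.1.2‖ := by
    refine max_le ?_ (by positivity)
    calc ⟪q.1.1 - q.1.2, (q.2 : V3)⟫_ℝ ≤ ‖q.1.1 - q.1.2‖ * ‖(q.2 : V3)‖ := real_inner_le_norm _ _
      _ = ‖q.1.1 - q.1.2‖ := by rw [mem_sphere_zero_iff_norm.1 q.2.2, mul_one]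
      _ ≤ ‖q.1.1‖ + ‖q.1.2‖ := norm_sub_le _ _
  simp only [collisionDensity]
  rw [ENNReal.ofReal_mul hB0, ENNReal.ofReal_mul (globalMaxwellian_pos _).le]
  gcongr
  calc ENNReal.ofReal (hardSphereKernel q.1 q.2) ≤ ENNReal.ofReal (‖q.1.1‖ + ‖q.1.2‖) :=
        ENNReal.ofReal_le_ofReal hB
    _ = ‖q.1.1‖ₑ + ‖q.1.2‖ₑ := by
        rw [ENNReal.ofReal_add (norm_nonneg _) (norm_nonneg _), ofReal_norm, ofReal_norm]

/-! ### The loss integral and the fibre bound -/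

/-- **Loss bound** (Tonelli): `∫ B M M_* g(v) g(v_*) dv dv_* dω ≤ 2 |S²| (∫ M g)(∫ ‖v‖ M g)`. -/
theorem lintegral_loss_le {g : V3 → ℝ≥0∞} (hg : Measurable g) :
    ∫⁻ q, ENNReal.ofReal (collisionDensity q) * (g q.1.1 * g q.1.2) ∂collMeasure ≤
      2 * sphereMeasure (Set.univ : Set (Metric.sphere (0 : V3) 1)) *
        ((∫⁻ v, ENNReal.ofReal (globalMaxwellian v) * g v) *
          ∫⁻ v, ‖v‖ₑ * (ENNReal.ofReal (globalMaxwellian v) * g v)) := by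
  haveI := isFiniteMeasure_sphereMeasure (E := V3)
  set a : V3 → ℝ≥0∞ := fun v => ENNReal.ofReal (globalMaxwellian v) * g v with ha
  have ham : Measurable a := continuous_globalMaxwellian.measurable.ennreal_ofReal.mul hg
  have hbm : Measurable fun v : V3 => ‖v‖ₑ * a v := measurable_enorm.mul ham
  set H : V3 × V3 → ℝ≥0∞ := fun p => ‖p.1‖ₑ * a p.1 * a p.2 + a p.1 * (‖p.2‖ₑ * a p.2) with hH
  have hH1 : Measurable fun p : V3 × V3 => ‖p.1‖ₑ * a p.1 * a p.2 :=
    (hbm.comp measurable_fst).mul (ham.comp measurable_snd)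
  have hH2 : Measurable fun p : V3 × V3 => a p.1 * (‖p.2‖ₑ * a p.2) :=
    (ham.comp measurable_fst).mul (hbm.comp measurable_snd)
  have hHm : Measurable H := hH1.add hH2
  have hpt : ∀ q : CollSpace, ENNReal.ofReal (collisionDensity q) * (g q.1.1 * g q.1.2) ≤ H q.1 := by
    intro q
    calc ENNReal.ofReal (collisionDensity q) * (g q.1.1 * g q.1.2)
        ≤ (‖q.1.1‖ₑ + ‖q.1.2‖ₑ) *
            (ENNReal.ofReal (globalMaxwellian q.1.1) * ENNReal.ofReal (globalMaxwellian q.1.2)) *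
            (g q.1.1 * g q.1.2) := by
          gcongr
          exact ofReal_collisionDensity_le q
      _ = H q.1 := by
          simp only [hH, ha]
          ring
  calc ∫⁻ q, ENNReal.ofReal (collisionDensity q) * (g q.1.1 * g q.1.2) ∂collMeasure
      ≤ ∫⁻ q, H q.1 ∂collMeasure := lintegral_mono hpt
    _ = ∫⁻ p, ∫⁻ _ω, H p ∂sphereMeasure ∂((volume : Measure V3).prod volume) := by
        unfold collMeasure
        exact lintegral_prod _ (hHm.comp measurable_fst).aemeasurable
    _ = ∫⁻ p, H p * sphereMeasure (Set.univ : Set (Metric.sphere (0 : V3) 1))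
          ∂((volume : Measure V3).prod volume) := by
        simp_rw [lintegral_const]
    _ = (∫⁻ p, H p ∂((volume : Measure V3).prod volume)) *
          sphereMeasure (Set.univ : Set (Metric.sphere (0 : V3) 1)) := lintegral_mul_const _ hHm
    _ = ((∫⁻ v, ‖v‖ₑ * a v) * (∫⁻ v, a v) + (∫⁻ v, a v) * ∫⁻ v, ‖v‖ₑ * a v) *
          sphereMeasure (Set.univ : Set (Metric.sphere (0 : V3) 1)) := by
        rw [lintegral_add_left hH1, lintegral_prod_mul hbm.aemeasurable ham.aemeasurable,
          lintegral_prod_mul ham.aemeasurable hbm.aemeasurable]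
    _ = _ := by ring

/-- **Fibre bound**: the Hellinger production of the velocity density `(g ·).toReal` (`g` measurable,
`ℝ≥0∞`-valued) is at most `4 |S²| (∫ M g dv)(∫ ‖v‖ M g dv)`. -/
theorem fibre_le {g : V3 → ℝ≥0∞} (hg : Measurable g) :
    ∫⁻ q, ENNReal.ofReal (collisionDensity q * hellingerDefect (fun w => (g w).toReal) q ^ 2) ∂collMeasure ≤
      4 * sphereMeasure (Set.univ : Set (Metric.sphere (0 : V3) 1)) *
        ((∫⁻ v, ENNReal.ofReal (globalMaxwellian v) * g v) *
          ∫⁻ v, ‖v‖ₑ * (ENNReal.ofReal (globalMaxwellian v) * g v)) := by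
  have hBm : Measurable fun q : CollSpace => ENNReal.ofReal (collisionDensity q) * (g q.1.1 * g q.1.2) :=
    measurable_collisionDensity.ennreal_ofReal.mul
      ((hg.comp (measurable_fst.comp measurable_fst)).mul (hg.comp (measurable_snd.comp measurable_fst)))
  have hgain : ∫⁻ q, ENNReal.ofReal (collisionDensity q) * (g (collide q.2 q.1).1 * g (collide q.2 q.1).2)
      ∂collMeasure = ∫⁻ q, ENNReal.ofReal (collisionDensity q) * (g q.1.1 * g q.1.2) ∂collMeasure :=
    lintegral_collisionDensity_mul_comp_collide_negDir (E := V3) (fun q => g q.1.1 * g q.1.2)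
  calc ∫⁻ q, ENNReal.ofReal (collisionDensity q * hellingerDefect (fun w => (g w).toReal) q ^ 2) ∂collMeasure
      ≤ ∫⁻ q, (ENNReal.ofReal (collisionDensity q) * (g (collide q.2 q.1).1 * g (collide q.2 q.1).2) +
          ENNReal.ofReal (collisionDensity q) * (g q.1.1 * g q.1.2)) ∂collMeasure :=
        lintegral_mono (integrand_le g)
    _ = 2 * ∫⁻ q, ENNReal.ofReal (collisionDensity q) * (g q.1.1 * g q.1.2) ∂collMeasure := by
        rw [lintegral_add_right _ hBm, hgain, two_mul]
    _ ≤ 2 * (2 * sphereMeasure (Set.univ : Set (Metric.sphere (0 : V3) 1)) *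
          ((∫⁻ v, ENNReal.ofReal (globalMaxwellian v) * g v) *
            ∫⁻ v, ‖v‖ₑ * (ENNReal.ofReal (globalMaxwellian v) * g v))) := by
        gcongr
        exact lintegral_loss_le hg
    _ = _ := by ring

/-- **Fibre bound, Gaussian form**: the production of `(g ·).toReal` is at most `4 |S²| (∫ g dγ)(∫ ‖w‖ g dγ)`. -/
theorem fibre_le_gauss {g : V3 → ℝ≥0∞} (hg : Measurable g) :
    ∫⁻ q, ENNReal.ofReal (collisionDensity q * hellingerDefect (fun w => (g w).toReal) q ^ 2) ∂collMeasure ≤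
      4 * sphereMeasure (Set.univ : Set (Metric.sphere (0 : V3) 1)) *
        ((∫⁻ w, g w ∂stdGaussian V3) * ∫⁻ w, ‖w‖ₑ * g w ∂stdGaussian V3) := by
  have hMm : Measurable fun v : V3 => ENNReal.ofReal (globalMaxwellian v) :=
    continuous_globalMaxwellian.measurable.ennreal_ofReal
  have h1 : ∫⁻ w, g w ∂stdGaussian V3 = ∫⁻ v, ENNReal.ofReal (globalMaxwellian v) * g v := by
    rw [stdGaussian_eq_withDensity_globalMaxwellian_holds, lintegral_withDensity_eq_lintegral_mul _ hMm hg]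
    rfl
  have h2 : ∫⁻ w, ‖w‖ₑ * g w ∂stdGaussian V3 =
      ∫⁻ v, ‖v‖ₑ * (ENNReal.ofReal (globalMaxwellian v) * g v) := by
    have hng : Measurable fun w : V3 => ‖w‖ₑ * g w := measurable_enorm.mul hg
    rw [stdGaussian_eq_withDensity_globalMaxwellian_holds, lintegral_withDensity_eq_lintegral_mul _ hMm hng]
    refine lintegral_congr fun v => ?_
    simp only [Pi.mul_apply]
    ring
  rw [h1, h2]
  exact fibre_le hg

/-! ### The position marginal of a law with a density against `vol ⊗ γ` -/

/-- `f₁ = (∫ df/dm dγ) · vol` for `f ≪ m = vol ⊗ γ` finite. -/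
theorem fst_eq_withDensity (f : Measure (T3 × V3)) [IsFiniteMeasure f] (hac : f ≪ refMeasure) :
    f.fst = (volume : Measure T3).withDensity
      (fun x => ∫⁻ w, f.rnDeriv refMeasure (x, w) ∂stdGaussian V3) := by
  haveI : SigmaFinite refMeasure := by
    change SigmaFinite ((volume : Measure T3).prod (stdGaussian V3)); infer_instance
  have hφ : Measurable (f.rnDeriv refMeasure) := Measure.measurable_rnDeriv _ _
  ext s hs
  rw [Measure.fst_apply hs, withDensity_apply _ hs, ← Set.prod_univ]
  conv_lhs => rw [← Measure.withDensity_rnDeriv_eq f refMeasure hac]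
  rw [withDensity_apply _ (hs.prod MeasurableSet.univ)]
  unfold refMeasure
  rw [← Measure.restrict_prod_eq_prod_univ]
  exact lintegral_prod _ hφ.aemeasurable

/-- `∫ dx ∫ ‖w‖ (df/dm)(x, w) γ(dw) = ∫ ‖w‖ df` for `f ≪ m = vol ⊗ γ` finite. -/
theorem lintegral_lintegral_enorm_mul_rnDeriv (f : Measure (T3 × V3)) [IsFiniteMeasure f]
    (hac : f ≪ refMeasure) :
    ∫⁻ x, ∫⁻ w, ‖w‖ₑ * f.rnDeriv refMeasure (x, w) ∂stdGaussian V3 = ∫⁻ y, ‖y.2‖ₑ ∂f := by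
  haveI : SigmaFinite refMeasure := by
    change SigmaFinite ((volume : Measure T3).prod (stdGaussian V3)); infer_instance
  have hφ : Measurable (f.rnDeriv refMeasure) := Measure.measurable_rnDeriv _ _
  have hm : Measurable fun y : T3 × V3 => ‖y.2‖ₑ * f.rnDeriv refMeasure y :=
    (measurable_snd.enorm).mul hφ
  calc ∫⁻ x, ∫⁻ w, ‖w‖ₑ * f.rnDeriv refMeasure (x, w) ∂stdGaussian V3
      = ∫⁻ y, ‖y.2‖ₑ * f.rnDeriv refMeasure y ∂refMeasure := by
        unfold refMeasure
        exact (lintegral_prod _ hm.aemeasurable).symm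
    _ = ∫⁻ y, ‖y.2‖ₑ ∂(refMeasure.withDensity (f.rnDeriv refMeasure)) := by
        rw [lintegral_withDensity_eq_lintegral_mul _ hφ measurable_snd.enorm]
        refine lintegral_congr fun y => ?_
        simp only [Pi.mul_apply]
        ring
    _ = ∫⁻ y, ‖y.2‖ₑ ∂f := by rw [Measure.withDensity_rnDeriv_eq f refMeasure hac]

/-! ### The cut production bound with the explicit constant `4 |S²|` -/

/-- **The a-priori bound with constant `4 |S²|`**: for `f ≪ vol ⊗ γ` finite and `K ≥ 0`,
`𝒟(1_{n ≤ K} df/dm) ≤ 4 |S²| K ∫ ‖w‖ df`. -/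
theorem production_cut_le (f : Measure (T3 × V3)) [IsFiniteMeasure f] (hac : f ≪ refMeasure) (K : ℝ) :
    production (Set.indicator ({x | (f.fst.rnDeriv volume x).toReal ≤ K} ×ˢ Set.univ)
        (fun y => (f.rnDeriv refMeasure y).toReal)) ≤
      4 * sphereMeasure (Set.univ : Set (Metric.sphere (0 : V3) 1)) * ENNReal.ofReal K *
        ∫⁻ y, ‖y.2‖ₑ ∂f := by
  have hφ : Measurable (f.rnDeriv refMeasure) := Measure.measurable_rnDeriv _ _
  set φ₁ : T3 → ℝ≥0∞ := fun x => ∫⁻ w, f.rnDeriv refMeasure (x, w) ∂stdGaussian V3 with hφ₁def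
  have hφ₁ : Measurable φ₁ := hφ.lintegral_prod_right'
  set m₁ : T3 → ℝ≥0∞ := fun x => ∫⁻ w, ‖w‖ₑ * f.rnDeriv refMeasure (x, w) ∂stdGaussian V3 with hm₁def
  have hm₁ : Measurable m₁ := ((measurable_snd.enorm).mul hφ).lintegral_prod_right'
  -- a.e. identification of the position density with `φ₁`
  have hae : ∀ᵐ x ∂(volume : Measure T3), f.fst.rnDeriv volume x = φ₁ x := by
    rw [fst_eq_withDensity f hac]
    exact Measure.rnDeriv_withDensity _ hφ₁
  have hlt : ∀ᵐ x ∂(volume : Measure T3), f.fst.rnDeriv volume x < ⊤ := Measure.rnDeriv_lt_top _ _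
  -- fibrewise bound
  have hfib : ∀ᵐ x ∂(volume : Measure T3),
      ∫⁻ q, ENNReal.ofReal (collisionDensity q * hellingerDefect (fun w =>
          Set.indicator ({x | (f.fst.rnDeriv volume x).toReal ≤ K} ×ˢ (Set.univ : Set V3))
            (fun y => (f.rnDeriv refMeasure y).toReal) (x, w)) q ^ 2) ∂collMeasure ≤
        4 * sphereMeasure (Set.univ : Set (Metric.sphere (0 : V3) 1)) * ENNReal.ofReal K * m₁ x := by
    filter_upwards [hae, hlt] with x hx hxlt
    by_cases hxE : (f.fst.rnDeriv volume x).toReal ≤ K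
    · have hsec : (fun w => Set.indicator ({x | (f.fst.rnDeriv volume x).toReal ≤ K} ×ˢ (Set.univ : Set V3))
          (fun y => (f.rnDeriv refMeasure y).toReal) (x, w)) =
          fun w => (f.rnDeriv refMeasure (x, w)).toReal := by
        funext w
        exact Set.indicator_of_mem
          (show (x, w) ∈ {x | (f.fst.rnDeriv volume x).toReal ≤ K} ×ˢ (Set.univ : Set V3) from
            ⟨hxE, Set.mem_univ _⟩) _
      rw [hsec]
      have hK' : φ₁ x ≤ ENNReal.ofReal K := by
        rw [← hx, ← ENNReal.ofReal_toReal hxlt.ne]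
        exact ENNReal.ofReal_le_ofReal hxE
      calc ∫⁻ q, ENNReal.ofReal (collisionDensity q *
            hellingerDefect (fun w => (f.rnDeriv refMeasure (x, w)).toReal) q ^ 2) ∂collMeasure
          ≤ 4 * sphereMeasure (Set.univ : Set (Metric.sphere (0 : V3) 1)) * (φ₁ x * m₁ x) :=
            fibre_le_gauss (g := fun w => f.rnDeriv refMeasure (x, w)) (hφ.comp measurable_prodMk_left)
        _ ≤ 4 * sphereMeasure (Set.univ : Set (Metric.sphere (0 : V3) 1)) * (ENNReal.ofReal K * m₁ x) := by
            gcongr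
        _ = _ := by ring
    · have hsec : (fun w => Set.indicator ({x | (f.fst.rnDeriv volume x).toReal ≤ K} ×ˢ (Set.univ : Set V3))
          (fun y => (f.rnDeriv refMeasure y).toReal) (x, w)) = fun _ => (0 : ℝ) := by
        funext w
        exact Set.indicator_of_notMem
          (show (x, w) ∉ {x | (f.fst.rnDeriv volume x).toReal ≤ K} ×ˢ (Set.univ : Set V3) from
            fun h => hxE h.1) _
      rw [hsec]
      simp [hellingerDefect]
  calc production (Set.indicator ({x | (f.fst.rnDeriv volume x).toReal ≤ K} ×ˢ Set.univ)
        (fun y => (f.rnDeriv refMeasure y).toReal))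
      ≤ ∫⁻ x, 4 * sphereMeasure (Set.univ : Set (Metric.sphere (0 : V3) 1)) * ENNReal.ofReal K * m₁ x :=
        lintegral_mono_ae hfib
    _ = 4 * sphereMeasure (Set.univ : Set (Metric.sphere (0 : V3) 1)) * ENNReal.ofReal K * ∫⁻ x, m₁ x :=
        lintegral_const_mul _ hm₁
    _ = _ := by rw [lintegral_lintegral_enorm_mul_rnDeriv f hac]

end CutProduction

/-- **Stub `stub_cutProductionLeMoment`** (registered signature): a-priori bound on the Hellinger production
below a density cut, `𝒟(1_{n ≤ K} df/dm) ≤ c K ∫ ‖w‖ df` with `c = 4 |S²|`. -/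
theorem stub_cutProductionLeMoment : CutProductionLeMoment := by
  refine ⟨4 * (sphereMeasure (Set.univ : Set (Metric.sphere (0 : V3) 1))).toReal, by positivity,
    fun f hf hac K _ => ?_⟩
  haveI := isFiniteMeasure_sphereMeasure (E := V3)
  have hc : ENNReal.ofReal (4 * (sphereMeasure (Set.univ : Set (Metric.sphere (0 : V3) 1))).toReal * K) =
      4 * sphereMeasure (Set.univ : Set (Metric.sphere (0 : V3) 1)) * ENNReal.ofReal K := by
    rw [ENNReal.ofReal_mul (by positivity), ENNReal.ofReal_mul (by norm_num),
      ENNReal.ofReal_toReal (measure_ne_top _ _), ENNReal.ofReal_ofNat]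
  rw [hc]
  exact CutProduction.production_cut_le f hac K

end Summit.AtomisticToContinuum.HydrodynamicLimit.Theorems.HTheorem

end
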